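import Literature.IUT.HodgeTheaters.PMBaseModelsProofs
import HarnessLib

/-!
# [IUTchI] Example 6.2 (ii), (iii): the orders of the poly-automorphisms `−1_{𝔽_l}` and `α^{Θ±}` — PROVED
# (proof-only companion of `PMBaseModels.lean`; abc-iut cell, layer L5, nodes IUTchI:Ex6.2(ii), IUTchI:Ex6.2(iii))

Mochizuki, *Inter-universal Teichmüller theory I*, §6, Example 6.2 (kurims May-2020 manuscript, p. 160)
[claim: Mochizuki2012, status: disputed]. `PMBaseModels.lean` (abc-iut-L5-t4) types the model
base-`Θ^±`-bridge `(𝔇_±, 𝔇_≻, φ^{Θ±}_±)` and its poly-automorphisms `−1_{𝔽_l}` (`Ex62.negOne`) and `α^{Θ±}`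
(`Ex62.signed α`), and PROVES the two printed compatibility claims (`Ex62.negOne_compatible`,
`Ex62.signed_compatible`). The two printed ORDER clauses —

* (ii) p. 160: "`(𝔇_±, 𝔇_≻, φ^{Θ±}_±)` admits a natural poly-automorphism **of order two** `−1_{𝔽_l}`";
* (iii) p. 160: "`α` determines a natural poly-automorphism `α^{Θ±}` **of order `∈ {1, 2}`**"

— were quoted in docstrings only. This file states and proves them WITHOUT new definitions, in the three
components of the typed `Ex62.PolyAut` (action on the index set `𝔽_l`; poly-isomorphisms on the capsule
`𝔇_±`; poly-isomorphism on `𝔇_≻`), composition of poly-morphisms being the tree's `DStrip.polyComp`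
([IUTchI] §0 p. 33) and the trivial poly-automorphism being the positive `+`-full poly-automorphism
`Aut_+(𝔇)` = `signedPolyAut (fun _ => 1)` (Def 6.1 (iii)–(iv), p. 157):

* `DStrip.polyComp_signedPolyAut`: `Aut^α(𝔇) · Aut^β(𝔇) = Aut^{αβ}(𝔇)` — the group `{±1}^𝕍` of signs acts
  on `+`-full poly-automorphisms through its multiplication (sign calculus of Def 6.1 (iii));
* `Ex62.negOne_perm_trans_self`, `Ex62.negOne_onCapsule_sq`, `Ex62.negOne_onCodomain_sq`,
  `Ex62.negOne_onCodomain_ne_one`: `−1_{𝔽_l} ∘ −1_{𝔽_l}` is the trivial poly-automorphism and `−1_{𝔽_l}`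
  itself is not (its `𝔇_≻`-component is `Aut_−`, disjoint from `Aut_+`) — ORDER EXACTLY TWO;
* `Ex62.signed_perm`, `Ex62.signed_onCapsule_sq`, `Ex62.signed_onCodomain_sq`: `α^{Θ±} ∘ α^{Θ±}` is trivial —
  ORDER DIVIDES TWO, i.e. `∈ {1, 2}` (order `1` iff `α ≡ +1`: `Ex62.signed_onCodomain_eq_one_iff`).

Proof-only; record-only; nothing here takes a side on [IUTchIII] Cor. 3.12; typed ≠ endorsed.
-/

namespace Literature.IUT.HodgeTheaters

namespace PMBaseKit

universe u

variable {l : ℕ} {K : PMBaseKit.{u} l}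

/-! ### Sign calculus for `+`-full poly-automorphisms: `Aut^α · Aut^β = Aut^{αβ}` -/

/-- For units `u, w ∈ {±1} = ℤˣ`: `(u = 1 ↔ w = 1) ↔ u·w = 1`. [claim: Mochizuki2012, status: disputed] -/
private theorem units_int_eq_one_iff_iff_mul_eq_one (u w : ℤˣ) : ((u = 1 ↔ w = 1) ↔ u * w = 1) := by
  rcases Int.units_eq_one_or u with hu | hu <;> rcases Int.units_eq_one_or w with hw | hw <;>
    subst hu <;> subst hw <;> decide

namespace DStrip

variable {D : K.DStrip}

/-- The composite of a member of `Aut^α(𝔇)` with a member of `Aut^β(𝔇)` lies in `Aut^{αβ}(𝔇)`: at each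
`v ∈ 𝕍` the sign of a composite is the product of the signs ([IUTchI] Def 6.1 (iii) p. 157, "natural
surjection `Aut(†𝒟_v) ↠ {±1}`"). [claim: Mochizuki2012, status: disputed] -/
theorem trans_mem_signedPolyAut_mul {α β : K.V → ℤˣ} {a b : D.Iso D}
    (ha : a ∈ D.signedPolyAut α) (hb : b ∈ D.signedPolyAut β) : a.trans b ∈ D.signedPolyAut (α * β) := by
  rw [mem_signedPolyAut_iff] at ha hb ⊢
  intro v
  change K.labMap v (a v ≪≫ b v) = Equiv.refl _ ↔ α v * β v = 1
  rw [labMap_trans_eq_refl_iff (D.isLocal v), ha v, hb v]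
  exact units_int_eq_one_iff_iff_mul_eq_one (α v) (β v)

/-- **`Aut^α(𝔇) · Aut^β(𝔇) = Aut^{αβ}(𝔇)`** as composite poly-morphisms ([IUTchI] §0 p. 33; Def 6.1
(iii)–(iv) p. 157): the group `{±1}^𝕍` acts on the signed `+`-full poly-automorphisms through its
multiplication. [claim: Mochizuki2012, status: disputed] -/
theorem polyComp_signedPolyAut (D : K.DStrip) (α β : K.V → ℤˣ) :
    DStrip.polyComp (D.signedPolyAut α) (D.signedPolyAut β) = D.signedPolyAut (α * β) := by
  obtain ⟨a, ha⟩ := exists_mem_signedPolyAut D α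
  obtain ⟨b, hb⟩ := exists_mem_signedPolyAut D β
  have hab := trans_mem_signedPolyAut_mul ha hb
  rw [signedPolyAut_eq_plusFullPolyIso ha, signedPolyAut_eq_plusFullPolyIso hb, polyComp_plusFullPolyIso,
    signedPolyAut_eq_plusFullPolyIso hab]

/-- In particular every `Aut^α(𝔇)` squares to the trivial poly-automorphism `Aut_+(𝔇) = Aut^{(+1,…,+1)}(𝔇)`
(`α² = 1` in `{±1}^𝕍`). [claim: Mochizuki2012, status: disputed] -/
theorem polyComp_signedPolyAut_self (D : K.DStrip) (α : K.V → ℤˣ) :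
    DStrip.polyComp (D.signedPolyAut α) (D.signedPolyAut α) = D.signedPolyAut fun _ => 1 := by
  rw [polyComp_signedPolyAut]
  congr 1
  funext v
  change α v * α v = 1
  rw [← sq, Int.units_sq]

/-- `Aut^α(𝔇) = Aut_+(𝔇)` iff `α ≡ +1` (injectivity of `α ↦ Aut^α(𝔇)`, Def 6.1 (iv) "precisely two").
[claim: Mochizuki2012, status: disputed] -/
theorem signedPolyAut_eq_one_iff (D : K.DStrip) (α : K.V → ℤˣ) :
    D.signedPolyAut α = D.signedPolyAut (fun _ => 1) ↔ α = fun _ => 1 :=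
  ⟨fun h => signedPolyAut_injective D h, fun h => by rw [h]⟩

end DStrip

/-! ### Example 6.2 (ii): `−1_{𝔽_l}` has order two -/

namespace Ex62

variable (K)

/-- (ii), index level: `−1_{𝔽_l}` acts on `𝔽_l` by an involution (`t ↦ −t ↦ t`).
([IUTchI] Ex 6.2 (ii) p.160) [claim: Mochizuki2012, status: disputed] -/
theorem negOne_perm_trans_self : (negOne K).perm.trans (negOne K).perm = Equiv.refl _ := by
  ext t
  simp [negOne]

/-- (ii), index level: but `−1_{𝔽_l}` is not the identity on `𝔽_l` as soon as `l > 2` (e.g. `1 ≠ −1`).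
([IUTchI] Ex 6.2 (ii) p.160) [claim: Mochizuki2012, status: disputed] -/
theorem negOne_perm_ne_refl (hl : 2 < l) : (negOne K).perm ≠ Equiv.refl _ := by
  intro h
  have h1 : (negOne K).perm 1 = 1 := by rw [h]; rfl
  simp only [negOne, Equiv.neg_apply] at h1
  have h2 : ((2 : ℕ) : ZMod l) = 0 := by
    have : (1 : ZMod l) + 1 = 0 := by
      calc (1 : ZMod l) + 1 = -1 + 1 := by rw [h1]
        _ = 0 := neg_add_cancel 1
    simpa [one_add_one_eq_two] using this
  rw [ZMod.natCast_eq_zero_iff] at h2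
  exact absurd (Nat.le_of_dvd two_pos h2) (not_le.mpr hl)

/-- (ii), capsule level: the composite poly-isomorphism `𝔇_t ⥲ 𝔇_{−t} ⥲ 𝔇_t` induced by `−1_{𝔽_l} ∘ −1_{𝔽_l}`
is the trivial (positive `+`-full) poly-automorphism `Aut_+(𝔇_t)`.
([IUTchI] Ex 6.2 (ii) p.160) [claim: Mochizuki2012, status: disputed] -/
theorem negOne_onCapsule_sq (t : ZMod l) :
    DStrip.polyComp ((negOne K).onCapsule t) ((negOne K).onCapsule ((negOne K).perm t)) =
      (DStrip.model K).signedPolyAut fun _ => 1 :=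
  DStrip.polyComp_signedPolyAut_self _ _

/-- (ii), `𝔇_≻` level: the composite `𝔇_≻ ⥲ 𝔇_≻ ⥲ 𝔇_≻` induced by `−1_{𝔽_l} ∘ −1_{𝔽_l}` is `Aut_+(𝔇_≻)`.
([IUTchI] Ex 6.2 (ii) p.160) [claim: Mochizuki2012, status: disputed] -/
theorem negOne_onCodomain_sq :
    DStrip.polyComp (negOne K).onCodomain (negOne K).onCodomain = (DStrip.model K).signedPolyAut fun _ => 1 :=
  DStrip.polyComp_signedPolyAut_self _ _

/-- (ii): `−1_{𝔽_l}` itself is NOT the trivial poly-automorphism — its `𝔇_≻`-component is the `+`-full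
poly-automorphism of negative sign at every `v`, which differs from `Aut_+(𝔇_≻)` as soon as `𝕍 ≠ ∅`;
together with `negOne_onCodomain_sq` this is "of order two" (exactly). ([IUTchI] Ex 6.2 (ii) p.160)
[claim: Mochizuki2012, status: disputed] -/
theorem negOne_onCodomain_ne_one [Nonempty K.V] :
    (negOne K).onCodomain ≠ (DStrip.model K).signedPolyAut fun _ => 1 := by
  intro h
  have h' := (DStrip.signedPolyAut_eq_one_iff (DStrip.model K) fun _ => -1).mp h
  have := congrFun h' (Classical.arbitrary K.V)
  exact absurd this (by decide)

/-! ### Example 6.2 (iii): `α^{Θ±}` has order `∈ {1, 2}` -/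

/-- (iii), index level: `α^{Θ±}` acts on `𝔽_l` as the identity. ([IUTchI] Ex 6.2 (iii) p.160)
[claim: Mochizuki2012, status: disputed] -/
theorem signed_perm (α : K.V → ℤˣ) : (signed K α).perm = Equiv.refl _ := rfl

/-- (iii), capsule level: `α^{Θ±} ∘ α^{Θ±}` induces on each `𝔇_t` the trivial poly-automorphism `Aut_+(𝔇_t)`
(`α² = 1`). ([IUTchI] Ex 6.2 (iii) p.160) [claim: Mochizuki2012, status: disputed] -/
theorem signed_onCapsule_sq (α : K.V → ℤˣ) (t : ZMod l) :
    DStrip.polyComp ((signed K α).onCapsule t) ((signed K α).onCapsule ((signed K α).perm t)) =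
      (DStrip.model K).signedPolyAut fun _ => 1 :=
  DStrip.polyComp_signedPolyAut_self _ _

/-- (iii), `𝔇_≻` level: `α^{Θ±} ∘ α^{Θ±}` induces on `𝔇_≻` the trivial poly-automorphism — so the order of
`α^{Θ±}` divides `2`, i.e. lies in `{1, 2}`. ([IUTchI] Ex 6.2 (iii) p.160) [claim: Mochizuki2012, status: disputed] -/
theorem signed_onCodomain_sq (α : K.V → ℤˣ) :
    DStrip.polyComp (signed K α).onCodomain (signed K α).onCodomain =
      (DStrip.model K).signedPolyAut fun _ => 1 :=
  DStrip.polyComp_signedPolyAut_self _ _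

/-- (iii): the order is `1` exactly when `α ≡ +1` — `α^{Θ±}` is the trivial poly-automorphism (on `𝔇_≻`,
equivalently on every `𝔇_t`) iff `α = (+1, …, +1)`. ([IUTchI] Ex 6.2 (iii) p.160)
[claim: Mochizuki2012, status: disputed] -/
theorem signed_onCodomain_eq_one_iff (α : K.V → ℤˣ) :
    (signed K α).onCodomain = (DStrip.model K).signedPolyAut (fun _ => 1) ↔ α = fun _ => 1 :=
  DStrip.signedPolyAut_eq_one_iff _ _

end Ex62

end PMBaseKit

end Literature.IUT.HodgeTheaters
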